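import Summits.BirchSwinnertonDyer.BirchSwinnertonDyer.Theses.TwistFamilyManinDescent
import Literature.NumberTheory.EllipticCurves.ModularCurveManinConstantProofs
import Literature.NumberTheory.EllipticCurves.HeegnerPointsOfConductor

/-!
# Ordinary CM torsor — first-lemma sketch (crux stmt-BirchSwinnertonDyer-25138, crux-ideate seat 1, g11)

Card `Ideas/ordinary-cm-torsor.md` of crux `TwistFamilyManinDescent.EisensteinAdditiveManinResidual`.

The lever in one line: on the ordinary tube `A` of the `∞`-component of `X₀(p²M)` over `ℤ_p` the tree's
defining identity `D.φ τ = D.uniformize (D.c * eichlerIntegral D.f τ)` has a rigid-analytic twin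
`log_E ∘ φ = c · d⁻¹f`, `d⁻¹f = Σ_{p ∤ n} (aₙ/n) qⁿ` (`a_p = 0` because `p² ∣ N`), `‖d⁻¹f‖_A = 1`
(q-expansion principle); so `v_p(c) = min_{x ∈ A} v(log_E φ(x))`, and ONE algebraic point `x ∈ A`
(unramified above `p`) with `φ(x) ∉ p·E⁰(𝒪_w)` certifies `p ∤ c`.  For a reducible `E[p] ⊃ C` the local
condition `φ(x) ∉ pE⁰` is the non-vanishing at `w` of the Eisenstein descent class `x^*[Y_S]`,
`S = ι(C) ⊂ J₀(N)[p]`; if `S` is cuspidal (`p·D_S = div g_S`) and `x` is an ordinary CM point, `x^*[Y_S]`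
is the Kummer class of the elliptic unit `g_S(x)` and its `w`-component in the `ω^{i}`-eigenspace
(`i = cwIndex p v ≡ −a`, or its Cartier mirror `1 + a`; both in `[2, p−2]` off the boundary rows, table below)
is the `i`-th Coates–Wiles homomorphism — a critical Hecke `L`-value of `K` mod `𝔭`, E-free.  The clean
squeeze behind it, (D): `p ∣ c ⟺ φ mod p COLLAPSES the outer components of X₀(p²M)_{𝔽_p}` (all rows), and the
two-sided torsor criterion needs the optimal curve's rational `p`-line to be ÉTALE-type at `p` (case A =
the route's I9 `OrdinaryCornerOptimalSerreTateDeep`, stmt-27660).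

Contents (kernel-checked, no `sorry`):
* E-free local row tables (`decide`): `tameIndex`, `etaleExponent` (Serre pair `{ω^{1+a}, ω^{-a}}`),
  `isBoundary` (`1 + a ≡ 0`: the multiplicative member is unramified), `cwIndex ≡ −a`, `cwIndexMirror ≡ 1 + a`;
  `etaleExponent_census` (matches CENSUS-packet-visibility-tables T1), `boundary_rows`
  (exactly `(5,3), (7,2)` among the crux rows), `cwIndex_window` / `cwIndexMirror_window` (`2 ≤ i ≤ p − 2`
  off the boundary), `cwIndex_boundary`, `cwIndex_table`.
* `OrdinaryTubeDatum D p` — the POSITED interface (dictionary (D1) `ordLog = v_p(c) + ordTheta`,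
  descent step (D2)+(L1) `KummerNonzero x → ordLog x = 0`); its CONSTRUCTION (rigid identity on the
  KM-model tube + Néron mapping property + `ψ^∨ E'⁰(H_w) = p E⁰(H_w)`) is stub S1 of any line, NOT a field.
* `OrdinaryTubeDatum.not_dvd_maninConstant` — one certifying point ⇒ `p ∤ c` (proved from the fields and
  `maninConstant_ne_zero_holds`); `OrdinaryTubeDatum.ordTheta_pos_of_dvd` — the converse squeeze.
* `IsOrdinaryHeegnerArgument N p τ` — the intended certifying points, typed over the tree's
  `heegnerPointOfConductor` / `HeegnerDatum`: conductor prime to `pN`, `p` split in `K` (`d` a non-zero square mod `p`).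
* `CMTorsorCertificate` (the line's E-sighted ∃-statement, crux hypotheses verbatim) and the proved link
  `crux_of_certificate : CMTorsorCertificate → EisensteinAdditiveManinResidual` (stmt-25138).

BSD is not proved by this; Manin `c = 1` is not proved by this.
-/

noncomputable section

set_option linter.dupNamespace false

open WeierstrassCurve Literature.NumberTheory.EllipticCurves.ModularForms
open Literature.NumberTheory.EllipticCurves

namespace Summit.BirchSwinnertonDyer.BirchSwinnertonDyer.Cruxes.EisensteinAdditiveManinResidual.OrdinaryCMTorsor

/-! ### E-free local tables of the rows (potentially good additive `p ≥ 5`, `v = v_p(Δ_min)`) -/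

/-- Tame ramification index `e = 12 / gcd(12, v)` of a potentially good additive fibre, by `v mod 12`. -/
def tameIndex (v : ℕ) : ℕ :=
  match v % 12 with
  | 0 => 1
  | 6 => 2
  | 4 => 3
  | 8 => 3
  | 3 => 4
  | 9 => 4
  | _ => 6

/-- Principal series (potentially ORDINARY) at `p`: `e ∣ p − 1`. -/
def isPrincipalSeries (p v : ℕ) : Bool := (p - 1) % tameIndex v == 0

/-- The exponent `a` of the Serre pair `ρ̄|_{I_p} ~ ω^{1+a} ⊕ ω^{-a}` of a principal-series row:
`a = (p−1)/e · j`, `j ≡ −v·e/12 (mod e)` (étale line `ω^{-a}`, multiplicative line `ω^{1+a}`). -/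
def etaleExponent (p v : ℕ) : ℕ :=
  (p - 1) / tameIndex v * ((tameIndex v - (v * tameIndex v / 12) % tameIndex v) % tameIndex v)

/-- BOUNDARY row: the multiplicative member `ω^{1+a}` is unramified (`1 + a ≡ 0 mod p − 1`); then
`E[p](ℚ_p^{nr}) ≠ 0` and `E⁰(H_w)` may have `p`-torsion — the rows the dictionary does not cover as is. -/
def isBoundary (p v : ℕ) : Bool := (1 + etaleExponent p v) % (p - 1) == 0

/-- The Coates–Wiles index: the exponent `i` of the `ω^i`-eigenspace of local units
`(H_w(μ_p, χ_C))^× ⊗ 𝔽_p` in which the Kummer class of the `C'`-torsor (`C' = E[p]/C ≅ C^D`) is read: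
`H¹(H_w, C') = (F^×/p ⊗ ω^{-1}χ')^{Δ}` is the `ω·χ'^{-1} = χ_C`-eigenspace, and `χ_C|_{I_p} = ω^{-a}` for the
étale-type line `C` (case A), so `i ≡ −a (mod p − 1)`.  The Cartier-dual normalisation gives the mirror
`1 + a`; `i + i^{mirror} ≡ 1`, and BOTH lie in the critical window off the boundary rows (`cwIndex_window`,
`cwIndexMirror_window`), while the boundary rows are exactly `{i, i^{mirror}} = {1, 0}`. -/
def cwIndex (p v : ℕ) : ℕ := (p - 1 - etaleExponent p v % (p - 1)) % (p - 1)

/-- The mirror (Cartier-dual) index `(1 + a) mod (p − 1)`. -/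
def cwIndexMirror (p v : ℕ) : ℕ := (1 + etaleExponent p v) % (p - 1)

/-- The crux rows `(p, v)`: `p ∈ {5, 7, 13, 163}`, `v = v_p(Δ_min) ∈ {2, 3, 4, 8, 9, 10}` (potentially good
additive with the `p*`-twist still additive: `v = 6`, the twist-good case, is excluded by the crux). -/
def cruxRows : List (ℕ × ℕ) :=
  [5, 7, 13, 163].flatMap fun p => [2, 3, 4, 8, 9, 10].map fun v => (p, v)

/-- Census check: the étale exponents of the `p = 5, 7` principal-series rows are
`(5,III)↦3, (5,III*)↦1, (7,II)↦5, (7,IV)↦4, (7,IV*)↦2, (7,II*)↦1`, i.e. Serre pairs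
`{1,ω}, {ω²,ω³}, {1,ω}, {ω⁵,ω²}, {ω³,ω⁴}, {ω²,ω⁵}` = table T1 of `CENSUS-packet-visibility-tables.md`. -/
theorem etaleExponent_census :
    [etaleExponent 5 3, etaleExponent 5 9, etaleExponent 7 2, etaleExponent 7 4,
      etaleExponent 7 8, etaleExponent 7 10] = [3, 1, 5, 4, 2, 1] := by decide

/-- Exactly two principal-series crux rows are boundary: `(5; III, v = 3)` and `(7; II, v = 2)`;
none at `p = 13` or `p = 163`. -/
theorem boundary_rows :
    cruxRows.filter (fun pv => isPrincipalSeries pv.1 pv.2 && isBoundary pv.1 pv.2) = [(5, 3), (7, 2)] := by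
  decide

/-- Off the boundary the Coates–Wiles index lies in the window `2 ≤ i ≤ p − 2` (a CRITICAL
eigenspace: neither the unramified one `i = 0` nor the `μ_p` one `i = 1`). -/
theorem cwIndex_window :
    (cruxRows.filter fun pv => isPrincipalSeries pv.1 pv.2 && !isBoundary pv.1 pv.2).all
      (fun pv => decide (2 ≤ cwIndex pv.1 pv.2 ∧ cwIndex pv.1 pv.2 ≤ pv.1 - 2)) = true := by
  decide

/-- The same window for the mirror normalisation. -/
theorem cwIndexMirror_window :
    (cruxRows.filter fun pv => isPrincipalSeries pv.1 pv.2 && !isBoundary pv.1 pv.2).all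
      (fun pv => decide (2 ≤ cwIndexMirror pv.1 pv.2 ∧ cwIndexMirror pv.1 pv.2 ≤ pv.1 - 2)) = true := by
  decide

/-- On the two boundary rows the pair of indices degenerates to `{1, 0}`. -/
theorem cwIndex_boundary :
    [(cwIndex 5 3, cwIndexMirror 5 3), (cwIndex 7 2, cwIndexMirror 7 2)] = [(1, 0), (1, 0)] := by decide

/-- The Coates–Wiles indices `(p, v, i, i^{mirror})` of the non-boundary principal-series rows at
`p = 5, 7, 13`: `(5;III*) ↦ 3|2`, `(7;IV) ↦ 2|5`, `(7;IV*) ↦ 4|3`, `(7;II*) ↦ 5|2`, `p = 13`: all seven rows. -/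
theorem cwIndex_table :
    ((cruxRows.filter fun pv => pv.1 ≠ 163 && isPrincipalSeries pv.1 pv.2 && !isBoundary pv.1 pv.2).map
      fun pv => (pv.1, pv.2, cwIndex pv.1 pv.2, cwIndexMirror pv.1 pv.2)) =
      [(5, 9, 3, 2), (7, 4, 2, 5), (7, 8, 4, 3), (7, 10, 5, 2), (13, 2, 2, 11), (13, 3, 3, 10),
        (13, 4, 4, 9), (13, 8, 8, 5), (13, 9, 9, 4), (13, 10, 10, 3)] := by
  decide

/-! ### The posited dictionary (construction = stub S1, never a field) -/

/-- **INTERFACE (posited; its construction on the non-boundary principal-series rows is stub S1).**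
`Pt` = certifying points (algebraic points of `X₀(N)` unramified above `p` reducing into the ordinary
locus of the `∞`-component, e.g. `IsOrdinaryHeegnerArgument`); `ordLog x = v_w(log_E φ(x))` (E-side),
`ordTheta x = v_w((d⁻¹f)(x))` (E-free CM value of the weight-0 `p`-adic modular form `d⁻¹f`);
(D1) the rigid identity `log_E ∘ φ = c · d⁻¹f` valued at `x`; (D2)+(L1) a non-zero local Eisenstein
descent class forces `φ(x) ∉ pE⁰(H_w)`, i.e. `ordLog x = 0`. -/
structure OrdinaryTubeDatum {N : ℕ} [NeZero N] {W : WeierstrassCurve ℚ}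
    (D : ModularParametrizationData W N) (p : ℕ) where
  /-- certifying points -/
  Pt : Type
  /-- `v_w(log_E φ(x))` -/
  ordLog : Pt → ℕ
  /-- `v_w((d⁻¹f)(x))`, E-free -/
  ordTheta : Pt → ℕ
  /-- (D1) `v(log_E φ(x)) = v_p(c) + v((d⁻¹f)(x))`. -/
  ordLog_eq : ∀ x, ordLog x = padicValInt p D.maninConstant + ordTheta x
  /-- the local descent class `x^*[Y_S]|_w` is non-zero (cuspidal `S`: the elliptic unit `g_S(x)` is not
  a local `p`-th power in the `ω^{cwIndex}`-eigenspace). -/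
  KummerNonzero : Pt → Prop
  /-- (D2)+(L1) `x^*[Y_S]|_w ≠ 0 → φ(x) ∉ pE⁰(H_w) → v(log_E φ(x)) = 0`. -/
  ordLog_eq_zero_of_kummer : ∀ x, KummerNonzero x → ordLog x = 0

namespace OrdinaryTubeDatum

variable {N : ℕ} [NeZero N] {W : WeierstrassCurve ℚ} {D : ModularParametrizationData W N} {p : ℕ}

/-- **One certifying point decides the crux for `E`:** `KummerNonzero x ⇒ p ∤ c_E`. -/
theorem not_dvd_maninConstant (hp : p.Prime) (T : OrdinaryTubeDatum D p) {x : T.Pt}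
    (hx : T.KummerNonzero x) : ¬ (p : ℤ) ∣ D.maninConstant := by
  haveI : Fact p.Prime := ⟨hp⟩
  have h0 := T.ordLog_eq x
  rw [T.ordLog_eq_zero_of_kummer x hx] at h0
  have hv : padicValInt p D.maninConstant = 0 := by omega
  have hc : D.maninConstant ≠ 0 := D.maninConstant_ne_zero_holds
  intro hdvd
  rcases (padicValInt_dvd_iff 1 D.maninConstant).mp (by simpa using hdvd) with h0' | h1
  · exact hc h0'
  · omega

/-- **The squeeze is two-sided:** if `p ∣ c` then every certifying point has `v((d⁻¹f)(x)) < v(log_E φ(x))`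
and a vanishing descent class — `p ∣ c` is VISIBLE at every ordinary CM point. -/
theorem not_kummer_of_dvd (hp : p.Prime) (T : OrdinaryTubeDatum D p) (h : (p : ℤ) ∣ D.maninConstant)
    (x : T.Pt) : ¬ T.KummerNonzero x :=
  fun hx => T.not_dvd_maninConstant hp hx h

theorem ordTheta_lt_ordLog_of_dvd (hp : p.Prime) (T : OrdinaryTubeDatum D p)
    (h : (p : ℤ) ∣ D.maninConstant) (x : T.Pt) : T.ordTheta x < T.ordLog x := by
  haveI : Fact p.Prime := ⟨hp⟩
  have hc : D.maninConstant ≠ 0 := D.maninConstant_ne_zero_holds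
  have h1 : 1 ≤ padicValInt p D.maninConstant := by
    rcases (padicValInt_dvd_iff 1 D.maninConstant).mp (by simpa using h) with h0 | h1
    · exact absurd h0 hc
    · exact h1
  have := T.ordLog_eq x
  omega

end OrdinaryTubeDatum

/-! ### The intended certifying points: ordinary Heegner arguments -/

/-- `τ = heegnerPointOfConductor d β n` is an ORDINARY HEEGNER ARGUMENT for `(N, p)`: `d` carries a
Heegner datum of level `N` with root `β`, `p` splits in `K = ℚ(√d)` (so `τ` reduces into the ordinary locus
of an outer component of `X₀(N)_{𝔽_p}`, `p² ∣ N`), and the conductor `n` is prime to `pN` (so `H = K[n]`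
is unramified above `p`).  The certifying values are `D.φ τ` (`heegnerPointComplexOfConductor`). -/
def IsOrdinaryHeegnerArgument (N : ℕ) [NeZero N] (p : ℕ) (τ : UpperHalfPlane) : Prop :=
  ∃ (d β : ℤ) (n : ℕ), (∃ H : HeegnerDatum N d, H.β = β) ∧ (¬ (p : ℤ) ∣ d ∧ ∃ r : ℤ, (p : ℤ) ∣ r ^ 2 - d) ∧
    Nat.Coprime n (p * N) ∧ τ = heegnerPointOfConductor d β n

/-! ### The line's statement and its proved link to the crux -/

/-- **(CMT) CM-torsor certificate** — the E-sighted ∃-form of the line, crux hypotheses verbatim: on every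
row of `EisensteinAdditiveManinResidual` the ordinary-tube dictionary is constructed and ONE certifying
point has a non-vanishing local Eisenstein descent class.  (= S1 construction ∧ K1 cuspidality ∧ CW
identification ∧ NV non-vanishing mod `𝔭` of the card; boundary rows `(5,3), (7,2)` need the torsion
bookkeeping of the card's open sub-question.) -/
def CMTorsorCertificate : Prop :=
  ∀ (W : WeierstrassCurve ℚ) [W.IsElliptic] [W.IsGloballyMinimal] {N : ℕ} [NeZero N]
    (D : ModularParametrizationData W N) (p : ℕ) (hp : p.Prime),
    (p = 5 ∨ p = 7 ∨ p = 13 ∨ (p = 163 ∧ 2 ^ 6 ∣ N)) → p ^ 2 ∣ N → ¬ W.HasIrreducibleModPGaloisRep p →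
    ¬ ((W.quadraticTwist (((-1 : ℤ) ^ (p / 2) * p : ℤ) : ℚ)).HasGoodReductionAt
          ((Rat.HeightOneSpectrum.primesEquiv (R := ℤ)).symm ⟨p, hp⟩) ∨
        (W.quadraticTwist (((-1 : ℤ) ^ (p / 2) * p : ℤ) : ℚ)).HasMultiplicativeReductionAt
          ((Rat.HeightOneSpectrum.primesEquiv (R := ℤ)).symm ⟨p, hp⟩)) →
    (∀ z ∈ D.L.lattice, ∃ w ∈ periodLattice D.f, z = D.c * w) →
    ∃ T : OrdinaryTubeDatum D p, ∃ x : T.Pt, T.KummerNonzero x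

/-- **Proved link:** `CMTorsorCertificate → EisensteinAdditiveManinResidual` (stmt-25138); the three
Manin named facts and `exists_isNewformOf` of the crux are not even used. -/
theorem crux_of_certificate (h : CMTorsorCertificate) :
    Theses.TwistFamilyManinDescent.EisensteinAdditiveManinResidual := by
  intro _ _ _ _ W _ _ N _ D p hp hrow hN hred htw hopt
  obtain ⟨T, x, hx⟩ := h W D p hp hrow hN hred htw hopt
  exact T.not_dvd_maninConstant hp hx

end Summit.BirchSwinnertonDyer.BirchSwinnertonDyer.Cruxes.EisensteinAdditiveManinResidual.OrdinaryCMTorsor
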